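import Mathlib
import HarnessLib
import Summits.HubbardSuperconductivity.HubbardSuperconductivity.Theorems.KLProgrammeKLRegimeSplitSymInterp
import Summits.HubbardSuperconductivity.HubbardSuperconductivity.Theorems.KLProgrammeKLRegimeVolumeLimitTorusPeriodisationSplit

/-!
# Route `KLProgramme` — ENGINE child `KLRegimeEngineV16` (stmt-HubbardSuperconductivity-20236), `stub_twoLeg_scale0`,
# conjunct (E3f-AT)₀ `TwoLegVolumeRateAT … 0`, spatial nested leg `hsp`: the symmetrised interpolant at TWO NESTED VOLUMES
# (cell gate-hubbard-kl, seat hubbard-kl-k3c5-p2 g6, β′ lane «semigroup defect», step (m5)-a of HOME/…/BETA-PRIME-ROADMAP.md)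

The scale-`n` local part `klLocalPart L M … K n θ = (symInterp L (klLocSelfEnergyRe L M … K n)).eval (klFermiPoint μ K θ)` is the
value AT AN OFF-LATTICE POINT of the `C₄ᵥ`-symmetrised trigonometric interpolant of lattice data; the two-volume rate of
`TwoLegVolumeRateAT` therefore compares `(symInterp L f).eval q` with `(symInterp L″ g).eval q` for NESTED volumes `L ∣ L″`
(`L″ = b·L`) at the same `q`.  By the value formula [tree] `eval_symInterp` both are position-space sums
`Σ_x c(x)·h_{|x̃₁|,|x̃₂|}(q)` of the cosine coefficients `c = torusCosCoeff` against harmonics indexed by the CENTRED representative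
of the site; the centred lift `clift x̄ := Torus.proj L″ (Torus.cRep x̄)` of a coarse site carries the SAME centred representative
(`valMinAbs_clift`), so the fine sum splits over the fibres of the reduction `red` into the lifted coarse sites and the rest:

* §1 `Torus.cRepZ = ZMod.valMinAbs` (`cRepZ_eq_valMinAbs`) and the centred lift preserves the harmonic index (`valMinAbs_clift`,
  `harmonicIdx_clift`);
* §2 **`abs_eval_symInterp_sub_le_pinned_add_far`**:
  `|(symInterp L f).eval q − (symInterp L″ g).eval q| ≤ Σ_{x̄} |c_f x̄ − c_g (clift x̄)| + Σ_{y ≠ clift (red y)} |c_g y|`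
  — the PINNED nested difference of the coefficients plus the fine FAR TAIL (every harmonic is bounded by `1`);
* §3 the periodised form **`abs_eval_symInterp_sub_le_periodise_add_two_far`**:
  `≤ Σ_{x̄} |c_f x̄ − Σ_{red y = x̄} c_g y| + 2·Σ_{y ≠ clift (red y)} |c_g y|`, and hence, when the coarse coefficients ARE the
  periodisation of the fine ones (`hper`), `≤ 2·far` (`abs_eval_symInterp_sub_le_two_far_of_periodise`) and
  `≤ 2·D/((L−1)/2+1)` from a first centred site moment `D` of `c_g` ([tree] `sum_far_norm_le_of_firstMoment`, k3c4-p1);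
* §4 **sampled symbols**: for `f = F ∘ p_L`, `g = F ∘ p_{L″}` (the SAME continuum function read on the two momentum grids — every
  explicit factor of the K-resummed two-leg identity is of this form) the coefficients periodise EXACTLY
  (`torusCosCoeff_sampled_periodise`, from [tree] `periodise_torusFourierInv_sampled`, k3c5-p3/k3c4-p1), so
  `|(symInterp L (F∘p_L)).eval q − (symInterp L″ (F∘p_{L″})).eval q| ≤ 2·far ≤ 2·D/((L−1)/2+1)`
  (`abs_eval_symInterp_sampled_sub_le_two_far`, `…_le_firstMoment`).

Proofs only (no definitions; lift, reduction and periodisation are written inline exactly as in `…VolumeLimitTorusPeriodisationSplit`);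
nothing is asserted about the model.  References: the value formula is the cell's (`…CountertermMuFlow`, `…SplitSymInterp`); Poisson
summation on nested tori: S. Friedli, Y. Velenik, *Statistical Mechanics of Lattice Systems* (CUP 2017) §10.4.
-/

noncomputable section

namespace Summit.HubbardSuperconductivity.HubbardSuperconductivity.Theorems.TwoVolumeDefect

set_option linter.dupNamespace false -- summit = problem name (single-conjunct summit), D-0017

open Real Finset Literature.MathematicalPhysics.QuantumLattice Literature.Probability.LatticeModels
open Summit.HubbardSuperconductivity.HubbardSuperconductivity.Theorems.KLRegimeSplit
open Summit.HubbardSuperconductivity.HubbardSuperconductivity.Theorems.TwoPointAssembly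

/-! ## §1 Centred representatives: `cRepZ = valMinAbs`; the centred lift keeps the harmonic index -/

/-- The tree's centred representative `Torus.cRepZ` IS Mathlib's `ZMod.valMinAbs` (both are the representative in `(−L/2, L/2]`). -/
theorem cRepZ_eq_valMinAbs {L : ℕ} [NeZero L] (a : ZMod L) : Torus.cRepZ a = a.valMinAbs := by
  symm
  rw [ZMod.valMinAbs_spec]
  refine ⟨(Torus.intCast_cRepZ a).symm, ?_⟩
  have h := Torus.two_mul_cRepZ_bounds a
  constructor <;> [skip; skip] <;> rw [mul_comm] <;> linarith [h.1, h.2]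

section Nested

variable {b m Mf : ℕ} [NeZero m] [NeZero Mf]

/-- **The centred lift keeps the centred representative**: for `Mf = b·m` and a coarse residue `a : ZMod m`,
`((cRepZ a : ℤ) : ZMod Mf).valMinAbs = cRepZ a` (the representative lies in `(−m/2, m/2] ⊆ (−Mf/2, Mf/2]`). -/
theorem valMinAbs_intCast_cRepZ (hM : Mf = b * m) (a : ZMod m) :
    (((Torus.cRepZ a : ℤ) : ZMod Mf)).valMinAbs = Torus.cRepZ a := by
  have hb : 1 ≤ b := Nat.one_le_iff_ne_zero.2 (by rintro rfl; exact NeZero.ne Mf (by simpa using hM))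
  have hmM : (m : ℤ) ≤ Mf := by
    have : m ≤ Mf := by rw [hM]; exact Nat.le_mul_of_pos_left m hb
    exact_mod_cast this
  rw [ZMod.valMinAbs_spec]
  refine ⟨rfl, ?_⟩
  have h := Torus.two_mul_cRepZ_bounds a
  constructor
  · rw [mul_comm]; linarith [h.1]
  · rw [mul_comm]; linarith [h.2]

/-- The centred lift `clift x̄ = proj Mf (cRep x̄)` keeps every coordinate's centred representative. -/
theorem valMinAbs_clift (hM : Mf = b * m) (xbar : TorusSite 2 m) (i : Fin 2) :
    ((Torus.proj Mf (Torus.cRep xbar)) i).valMinAbs = (xbar i).valMinAbs := by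
  rw [Torus.proj_apply, Torus.cRep, valMinAbs_intCast_cRepZ hM, cRepZ_eq_valMinAbs]

/-- The centred lift keeps the harmonic index `(|x̃₁|, |x̃₂|)`. -/
theorem harmonicIdx_clift (hM : Mf = b * m) (xbar : TorusSite 2 m) (i : Fin 2) :
    ((Torus.proj Mf (Torus.cRep xbar)) i).valMinAbs.natAbs = (xbar i).valMinAbs.natAbs := by
  rw [valMinAbs_clift hM]

/-! ## §2 The value difference at two nested volumes: pinned coefficient difference plus the fine far tail -/

/-- The fine value sum regrouped over the fibres of the reduction `red y = (y_i.val : ZMod m)_i`. -/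
theorem eval_symInterp_eq_sum_fibre (g : TorusSite 2 Mf → ℝ) (q : Fin 2 → ℝ) :
    (symInterp Mf g).eval q = ∑ xbar : TorusSite 2 m,
      ∑ y ∈ univ.filter (fun y : TorusSite 2 Mf => (fun i => (((y i).val : ℕ) : ZMod m)) = xbar),
        torusCosCoeff Mf g y * TrigPolyC4v.harmonic (y 0).valMinAbs.natAbs (y 1).valMinAbs.natAbs q := by
  classical
  rw [eval_symInterp]
  exact (Finset.sum_fiberwise univ (fun y : TorusSite 2 Mf => (fun i => (((y i).val : ℕ) : ZMod m)))
    (fun y => torusCosCoeff Mf g y * TrigPolyC4v.harmonic (y 0).valMinAbs.natAbs (y 1).valMinAbs.natAbs q)).symm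

/-- **THE TWO-VOLUME VALUE SPLIT.**  For nested volumes `Mf = b·m`, real lattice data `f` (coarse) and `g` (fine), and every continuum
momentum `q`: `|(symInterp m f).eval q − (symInterp Mf g).eval q| ≤ Σ_{x̄} |c_f x̄ − c_g (clift x̄)| + Σ_{y ≠ clift (red y)} |c_g y|`
(`c = torusCosCoeff`, `clift x̄ = proj Mf (cRep x̄)`, `red y = (y_i.val : ZMod m)_i`). -/
theorem abs_eval_symInterp_sub_le_pinned_add_far (hM : Mf = b * m) (f : TorusSite 2 m → ℝ) (g : TorusSite 2 Mf → ℝ)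
    (q : Fin 2 → ℝ) :
    |(symInterp m f).eval q - (symInterp Mf g).eval q| ≤
      (∑ xbar : TorusSite 2 m, |torusCosCoeff m f xbar - torusCosCoeff Mf g (Torus.proj Mf (Torus.cRep xbar))|) +
        ∑ y ∈ univ.filter (fun y : TorusSite 2 Mf => Torus.proj Mf (Torus.cRep (fun i => (((y i).val : ℕ) : ZMod m))) ≠ y),
          |torusCosCoeff Mf g y| := by
  classical
  -- abbreviations
  set red : TorusSite 2 Mf → TorusSite 2 m := fun y i => (((y i).val : ℕ) : ZMod m) with hred
  set cl : TorusSite 2 m → TorusSite 2 Mf := fun xbar => Torus.proj Mf (Torus.cRep xbar) with hcl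
  set H : TorusSite 2 Mf → ℝ := fun y => TrigPolyC4v.harmonic (y 0).valMinAbs.natAbs (y 1).valMinAbs.natAbs q with hH
  set Hc : TorusSite 2 m → ℝ := fun x => TrigPolyC4v.harmonic (x 0).valMinAbs.natAbs (x 1).valMinAbs.natAbs q with hHc
  have hHcl : ∀ xbar, H (cl xbar) = Hc xbar := by
    intro xbar
    simp only [hH, hHc, hcl, harmonicIdx_clift hM]
  have hH1 : ∀ y, |H y| ≤ 1 := fun y => TrigPolyC4v.abs_harmonic_le_one _ _ _
  have hHc1 : ∀ x, |Hc x| ≤ 1 := fun x => TrigPolyC4v.abs_harmonic_le_one _ _ _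
  have hredcl : ∀ xbar, red (cl xbar) = xbar := fun xbar => reduce_clift hM xbar
  -- the far tail regrouped fibrewise
  have hfar : ∑ y ∈ univ.filter (fun y : TorusSite 2 Mf => cl (red y) ≠ y), |torusCosCoeff Mf g y| =
      ∑ xbar : TorusSite 2 m, ∑ y ∈ (univ.filter (fun y : TorusSite 2 Mf => red y = xbar)).erase (cl xbar),
        |torusCosCoeff Mf g y| := by
    rw [← Finset.sum_fiberwise (univ.filter (fun y : TorusSite 2 Mf => cl (red y) ≠ y)) red (fun y => |torusCosCoeff Mf g y|)]
    refine Finset.sum_congr rfl fun xbar _ => ?_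
    rw [fibre_erase_clift_eq xbar]
  -- coarse and fine value formulas
  have hc : (symInterp m f).eval q = ∑ xbar : TorusSite 2 m, torusCosCoeff m f xbar * Hc xbar := eval_symInterp m f q
  have hf : (symInterp Mf g).eval q = ∑ xbar : TorusSite 2 m,
      ∑ y ∈ univ.filter (fun y : TorusSite 2 Mf => red y = xbar), torusCosCoeff Mf g y * H y := eval_symInterp_eq_sum_fibre g q
  rw [hc, hf, hfar, ← Finset.sum_sub_distrib, ← Finset.sum_add_distrib]
  refine (abs_sum_le_sum_abs _ _).trans (Finset.sum_le_sum fun xbar _ => ?_)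
  have hmem : cl xbar ∈ univ.filter (fun y : TorusSite 2 Mf => red y = xbar) :=
    Finset.mem_filter.2 ⟨Finset.mem_univ _, hredcl xbar⟩
  rw [← Finset.add_sum_erase _ _ hmem, hHcl, ← sub_sub, ← sub_mul]
  refine (abs_sub _ _).trans (add_le_add ?_ ?_)
  · rw [abs_mul]
    exact mul_le_of_le_one_right (abs_nonneg _) (hHc1 xbar)
  · refine (abs_sum_le_sum_abs _ _).trans (Finset.sum_le_sum fun y _ => ?_)
    rw [abs_mul]
    exact mul_le_of_le_one_right (abs_nonneg _) (hH1 y)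

/-! ## §3 Periodised form; the rate from a first centred site moment of the fine coefficients -/

/-- The pinned coefficient difference is within the far tail of the periodised one:
`Σ_{x̄} |c_f x̄ − c_g (clift x̄)| ≤ Σ_{x̄} |c_f x̄ − Σ_{red y = x̄} c_g y| + Σ_{y ≠ clift (red y)} |c_g y|`. -/
theorem sum_abs_sub_clift_le_periodise_add_far (hM : Mf = b * m) (cf : TorusSite 2 m → ℝ) (cg : TorusSite 2 Mf → ℝ) :
    (∑ xbar : TorusSite 2 m, |cf xbar - cg (Torus.proj Mf (Torus.cRep xbar))|) ≤
      (∑ xbar : TorusSite 2 m, |cf xbar - ∑ y ∈ univ.filter (fun y : TorusSite 2 Mf => (fun i => (((y i).val : ℕ) : ZMod m)) = xbar), cg y|) +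
        ∑ y ∈ univ.filter (fun y : TorusSite 2 Mf => Torus.proj Mf (Torus.cRep (fun i => (((y i).val : ℕ) : ZMod m))) ≠ y), |cg y| := by
  classical
  set red : TorusSite 2 Mf → TorusSite 2 m := fun y i => (((y i).val : ℕ) : ZMod m) with hred
  set cl : TorusSite 2 m → TorusSite 2 Mf := fun xbar => Torus.proj Mf (Torus.cRep xbar) with hcl
  have hredcl : ∀ xbar, red (cl xbar) = xbar := fun xbar => reduce_clift hM xbar
  have hfar : ∑ y ∈ univ.filter (fun y : TorusSite 2 Mf => cl (red y) ≠ y), |cg y| =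
      ∑ xbar : TorusSite 2 m, ∑ y ∈ (univ.filter (fun y : TorusSite 2 Mf => red y = xbar)).erase (cl xbar), |cg y| := by
    rw [← Finset.sum_fiberwise (univ.filter (fun y : TorusSite 2 Mf => cl (red y) ≠ y)) red (fun y => |cg y|)]
    refine Finset.sum_congr rfl fun xbar _ => ?_
    rw [fibre_erase_clift_eq xbar]
  rw [hfar, ← Finset.sum_add_distrib]
  refine Finset.sum_le_sum fun xbar _ => ?_
  have hmem : cl xbar ∈ univ.filter (fun y : TorusSite 2 Mf => red y = xbar) :=
    Finset.mem_filter.2 ⟨Finset.mem_univ _, hredcl xbar⟩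
  have hsplit : ∑ y ∈ univ.filter (fun y : TorusSite 2 Mf => red y = xbar), cg y =
      cg (cl xbar) + ∑ y ∈ (univ.filter (fun y : TorusSite 2 Mf => red y = xbar)).erase (cl xbar), cg y :=
    (Finset.add_sum_erase _ _ hmem).symm
  have key : cf xbar - cg (cl xbar) =
      (cf xbar - ∑ y ∈ univ.filter (fun y : TorusSite 2 Mf => red y = xbar), cg y) +
        ∑ y ∈ (univ.filter (fun y : TorusSite 2 Mf => red y = xbar)).erase (cl xbar), cg y := by
    rw [hsplit]; ring
  rw [key]
  exact (abs_add_le _ _).trans (add_le_add le_rfl (abs_sum_le_sum_abs _ _))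

/-- **Periodised form of the two-volume value split**:
`|(symInterp m f).eval q − (symInterp Mf g).eval q| ≤ Σ_{x̄} |c_f x̄ − Σ_{red y = x̄} c_g y| + 2·Σ_{y ≠ clift (red y)} |c_g y|`. -/
theorem abs_eval_symInterp_sub_le_periodise_add_two_far (hM : Mf = b * m) (f : TorusSite 2 m → ℝ) (g : TorusSite 2 Mf → ℝ)
    (q : Fin 2 → ℝ) :
    |(symInterp m f).eval q - (symInterp Mf g).eval q| ≤
      (∑ xbar : TorusSite 2 m, |torusCosCoeff m f xbar -
        ∑ y ∈ univ.filter (fun y : TorusSite 2 Mf => (fun i => (((y i).val : ℕ) : ZMod m)) = xbar), torusCosCoeff Mf g y|) +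
        2 * ∑ y ∈ univ.filter (fun y : TorusSite 2 Mf => Torus.proj Mf (Torus.cRep (fun i => (((y i).val : ℕ) : ZMod m))) ≠ y),
          |torusCosCoeff Mf g y| := by
  have h1 := abs_eval_symInterp_sub_le_pinned_add_far hM f g q
  have h2 := sum_abs_sub_clift_le_periodise_add_far hM (torusCosCoeff m f) (torusCosCoeff Mf g)
  linarith

/-- **If the coarse coefficients ARE the periodisation of the fine ones, only the far tail is owed (twice).** -/
theorem abs_eval_symInterp_sub_le_two_far_of_periodise (hM : Mf = b * m) (f : TorusSite 2 m → ℝ) (g : TorusSite 2 Mf → ℝ)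
    (hper : ∀ xbar : TorusSite 2 m, torusCosCoeff m f xbar =
      ∑ y ∈ univ.filter (fun y : TorusSite 2 Mf => (fun i => (((y i).val : ℕ) : ZMod m)) = xbar), torusCosCoeff Mf g y)
    (q : Fin 2 → ℝ) :
    |(symInterp m f).eval q - (symInterp Mf g).eval q| ≤
      2 * ∑ y ∈ univ.filter (fun y : TorusSite 2 Mf => Torus.proj Mf (Torus.cRep (fun i => (((y i).val : ℕ) : ZMod m))) ≠ y),
        |torusCosCoeff Mf g y| := by
  have h := abs_eval_symInterp_sub_le_periodise_add_two_far hM f g q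
  have h0 : ∑ xbar : TorusSite 2 m, |torusCosCoeff m f xbar -
      ∑ y ∈ univ.filter (fun y : TorusSite 2 Mf => (fun i => (((y i).val : ℕ) : ZMod m)) = xbar), torusCosCoeff Mf g y| = 0 := by
    refine Finset.sum_eq_zero fun xbar _ => ?_
    rw [hper xbar, sub_self, abs_zero]
  linarith

omit [NeZero m] in
/-- The real far tail is the complex far tail of the cast coefficients (bookkeeping for the tree's `ℂ`-valued periodisation lemmas). -/
theorem sum_far_abs_eq_sum_far_norm_ofReal (cg : TorusSite 2 Mf → ℝ) :
    ∑ y ∈ univ.filter (fun y : TorusSite 2 Mf => Torus.proj Mf (Torus.cRep (fun i => (((y i).val : ℕ) : ZMod m))) ≠ y), |cg y| =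
      ∑ y ∈ univ.filter (fun y : TorusSite 2 Mf => Torus.proj Mf (Torus.cRep (fun i => (((y i).val : ℕ) : ZMod m))) ≠ y),
        ‖((cg y : ℝ) : ℂ)‖ := by
  refine Finset.sum_congr rfl fun y _ => ?_
  rw [Complex.norm_real, Real.norm_eq_abs]

/-- **The far tail from a first centred site moment** (real currency of [tree] `sum_far_norm_le_of_firstMoment`):
`Σ_{y ≠ clift (red y)} |c y| ≤ D / ((m−1)/2+1)` whenever `Σ_y (Σ_i |cRepZ (y i)|)·|c y| ≤ D`. -/
theorem sum_far_abs_le_of_firstMoment (hM : Mf = b * m) (cg : TorusSite 2 Mf → ℝ) {D : ℝ}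
    (hD : ∑ y : TorusSite 2 Mf, (∑ i, |(Torus.cRepZ (y i) : ℝ)|) * |cg y| ≤ D) :
    ∑ y ∈ univ.filter (fun y : TorusSite 2 Mf => Torus.proj Mf (Torus.cRep (fun i => (((y i).val : ℕ) : ZMod m))) ≠ y), |cg y| ≤
      D / (((m - 1) / 2 + 1 : ℕ) : ℝ) := by
  rw [sum_far_abs_eq_sum_far_norm_ofReal]
  refine sum_far_norm_le_of_firstMoment hM (fun y => ((cg y : ℝ) : ℂ)) ?_
  refine le_trans (le_of_eq (Finset.sum_congr rfl fun y _ => ?_)) hD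
  rw [Complex.norm_real, Real.norm_eq_abs]

/-- **Two-volume value difference from the periodisation identity and a first moment**:
`|(symInterp m f).eval q − (symInterp Mf g).eval q| ≤ 2·D/((m−1)/2+1)`. -/
theorem abs_eval_symInterp_sub_le_firstMoment_of_periodise (hM : Mf = b * m) (f : TorusSite 2 m → ℝ) (g : TorusSite 2 Mf → ℝ)
    (hper : ∀ xbar : TorusSite 2 m, torusCosCoeff m f xbar =
      ∑ y ∈ univ.filter (fun y : TorusSite 2 Mf => (fun i => (((y i).val : ℕ) : ZMod m)) = xbar), torusCosCoeff Mf g y)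
    {D : ℝ} (hD : ∑ y : TorusSite 2 Mf, (∑ i, |(Torus.cRepZ (y i) : ℝ)|) * |torusCosCoeff Mf g y| ≤ D) (q : Fin 2 → ℝ) :
    |(symInterp m f).eval q - (symInterp Mf g).eval q| ≤ 2 * (D / (((m - 1) / 2 + 1 : ℕ) : ℝ)) :=
  (abs_eval_symInterp_sub_le_two_far_of_periodise hM f g hper q).trans
    (mul_le_mul_of_nonneg_left (sum_far_abs_le_of_firstMoment hM _ hD) zero_le_two)

/-! ## §4 Sampled symbols: the coefficients periodise exactly, so only the far tail is owed -/

/-- The cosine coefficient of real lattice data is the real part of the inverse torus Fourier transform of the cast data: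
`torusCosCoeff L f x = Re (torusFourierInv (f : ℂ) x)`. -/
theorem torusCosCoeff_eq_re_torusFourierInv {L : ℕ} [NeZero L] (f : TorusSite 2 L → ℝ) (x : TorusSite 2 L) :
    torusCosCoeff L f x = (torusFourierInv (fun k => ((f k : ℝ) : ℂ)) x).re := by
  rw [torusCosCoeff_eq_re, torusFourierInv_eq_sum_torusChar]
  have hL : (((L : ℂ) ^ 2)⁻¹) = ((((L : ℝ) ^ 2)⁻¹ : ℝ) : ℂ) := by push_cast; ring
  rw [hL, Complex.re_ofReal_mul]

/-- **Sampled symbols periodise exactly at the level of cosine coefficients**: for `f = F∘p_m`, `g = F∘p_{Mf}` with a real continuum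
function `F`, `c_f x̄ = Σ_{red y = x̄} c_g y` ([tree] `periodise_torusFourierInv_sampled` read through `Re`). -/
theorem torusCosCoeff_sampled_periodise (hM : Mf = b * m) (F : (Fin 2 → ℝ) → ℝ) (xbar : TorusSite 2 m) :
    torusCosCoeff m (fun k => F (latticeMomentum m k)) xbar =
      ∑ y ∈ univ.filter (fun y : TorusSite 2 Mf => (fun i => (((y i).val : ℕ) : ZMod m)) = xbar),
        torusCosCoeff Mf (fun k => F (latticeMomentum Mf k)) y := by
  simp_rw [torusCosCoeff_eq_re_torusFourierInv]
  rw [← Complex.re_sum]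
  congr 1
  exact (periodise_torusFourierInv_sampled hM (fun p => ((F p : ℝ) : ℂ)) xbar).symm

/-- **Two nested volumes, one sampled symbol: only the fine far tail is owed.**
`|(symInterp m (F∘p_m)).eval q − (symInterp Mf (F∘p_{Mf})).eval q| ≤ 2·Σ_{y ≠ clift (red y)} |c_{F∘p_{Mf}} y|`. -/
theorem abs_eval_symInterp_sampled_sub_le_two_far (hM : Mf = b * m) (F : (Fin 2 → ℝ) → ℝ) (q : Fin 2 → ℝ) :
    |(symInterp m (fun k => F (latticeMomentum m k))).eval q - (symInterp Mf (fun k => F (latticeMomentum Mf k))).eval q| ≤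
      2 * ∑ y ∈ univ.filter (fun y : TorusSite 2 Mf => Torus.proj Mf (Torus.cRep (fun i => (((y i).val : ℕ) : ZMod m))) ≠ y),
        |torusCosCoeff Mf (fun k => F (latticeMomentum Mf k)) y| :=
  abs_eval_symInterp_sub_le_two_far_of_periodise hM _ _ (torusCosCoeff_sampled_periodise hM F) q

/-- **Sampled symbol, rate from the first centred site moment of the fine coefficients**:
`|(symInterp m (F∘p_m)).eval q − (symInterp Mf (F∘p_{Mf})).eval q| ≤ 2·D/((m−1)/2+1)`. -/
theorem abs_eval_symInterp_sampled_sub_le_firstMoment (hM : Mf = b * m) (F : (Fin 2 → ℝ) → ℝ) {D : ℝ}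
    (hD : ∑ y : TorusSite 2 Mf, (∑ i, |(Torus.cRepZ (y i) : ℝ)|) * |torusCosCoeff Mf (fun k => F (latticeMomentum Mf k)) y| ≤ D)
    (q : Fin 2 → ℝ) :
    |(symInterp m (fun k => F (latticeMomentum m k))).eval q - (symInterp Mf (fun k => F (latticeMomentum Mf k))).eval q| ≤
      2 * (D / (((m - 1) / 2 + 1 : ℕ) : ℝ)) :=
  abs_eval_symInterp_sub_le_firstMoment_of_periodise hM _ _ (torusCosCoeff_sampled_periodise hM F) hD q

end Nested

end Summit.HubbardSuperconductivity.HubbardSuperconductivity.Theorems.TwoVolumeDefect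

end
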